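import Literature.AlgebraicGeometry.Resolution.AlterationsSemiStableCodimTwo
import Mathlib.AlgebraicGeometry.Morphisms.Proper
import Mathlib.AlgebraicGeometry.Noetherian
import Mathlib.Data.ENat.Basic
import HarnessLib

/-!
# The generic fibre of a proper scheme over a local ring: stalk dimensions, and finiteness of closed subsets of the generic fibre

Topic: `Literature/AlgebraicGeometry/Morphisms`. PROVED, def-free, folklore — the «chain argument through a closed point of the special
fibre» for a proper `r : C → Spec O` over a LOCAL ring `O`, in the `ringKrullDim`-of-stalks currency of Stacks 02IZ (Mathlib
`ringKrullDim_stalk_eq_coheight`; the tree's `Literature.AlgebraicGeometry.Resolution.ringKrullDim_stalk_lt_of_specializes`: on a locally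
Noetherian scheme `y ⤳ x`, `y ≠ x` ⇒ `dim 𝒪_{X,y} < dim 𝒪_{X,x}`, REUSED), together with the finiteness of the maximal points of a closed subset of
a Noetherian sober space (the tree's `Set.Finite.of_forall_specializes_eq`, REUSED).

* `apply_eq_closedPoint_of_isClosed_singleton` — a CLOSED point of `C` lies over the closed point of `O` (`r` is a closed map).
* **`ringKrullDim_stalk_le_of_ne_closedPoint`** — if `dim 𝒪_{C,c} ≤ d + 1` at every closed point `c`, then `dim 𝒪_{C,x} ≤ d` at every point
  `x` NOT over the closed point: every point specialises to a closed point (`C` is quasi-compact), which lies over the closed point, and the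
  dimension drops strictly. At `d = 1`: «the generic fibre of a proper `O`-scheme of dimension `2` has dimension `≤ 1`».
* `one_le_ringKrullDim_stalk_of_ne_genericPoint` — on an irreducible locally Noetherian scheme, `1 ≤ dim 𝒪_{X,x}` off the generic point.
* **`Set.Finite.of_closed_in_genericFibre`** — with `h1 : dim 𝒪_{C,x} ≤ 1` on the generic-fibre locus as a HYPOTHESIS: a set `T` of
  generic-fibre points, closed in the generic-fibre locus and consisting of points of non-zero stalk dimension, is FINITE (its points are
  maximal points of `closure T`).
* `Set.Finite.preimage_singleton_of_ne_closedPoint` — packaged for quasi-finiteness (Mathlib `locallyQuasiFinite_iff_finite_preimage_singleton`):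
  for ANY morphism `φ : C → P`, `C` irreducible with `dim ≤ 2` at closed points, and `y : P` whose `φ`-preimages lie off the closed point and
  which is not `φ(η_C)`: `φ ⁻¹' {y}` is finite.
* `isClosed_singleton_of_specializes_of_ne` / **`finite_closure_singleton_inter_closedFibre`** — if all stalks have `dim ≤ 2` and `x` has
  `dim 𝒪_{C,x} ≥ 1`, every strict specialisation of `x` is a CLOSED point (over the closed point), and `closure {x}` meets the closed fibre in a
  finite set.
Written for res-L1-w45b-lead-2's LINE (T-j)-PROOF of F-102 `GenusZeroOverCompleteDVR` (step S6 «`φ : C → ℙ¹_O` is quasi-finite»),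
cell `res-hironaka`, by res-D-pv-035; the statements are context-free.

## Sources
* The Stacks Project, Tag 02IZ (dimension of local rings and specialisation), Tag 0052 (Noetherian spaces), Tag 01J7. [cite: StacksProject, Tag 02IZ]
* U. Görtz, T. Wedhorn, *Algebraic Geometry I* (2nd ed. 2020), Remark 12.57 (closed maps to a local base), Prop. 5.7 / §14.3 (dimension and
  generization). [cite: GortzWedhorn2020, Remark 12.57] (index only)
-/

noncomputable section

open CategoryTheory AlgebraicGeometry TopologicalSpace Topology IsLocalRing
open Literature.AlgebraicGeometry.Resolution

universe u

namespace Literature.AlgebraicGeometry.Morphisms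

/-! ## Arithmetic in `WithBot ℕ∞` -/

/-- `a < d + 1` forces `a ≤ d` in `WithBot ℕ∞`, for a natural number `d`. [folklore] -/
private theorem WithBot.ENat.le_natCast_of_lt_succ {a : WithBot ℕ∞} {d : ℕ} (h : a < ((d + 1 : ℕ) : WithBot ℕ∞)) :
    a ≤ (d : WithBot ℕ∞) := by
  induction a using WithBot.recBotCoe with
  | bot => exact bot_le
  | coe a =>
    induction a using ENat.recTopCoe with
    | top =>
      have h' : (⊤ : ℕ∞) < ((d + 1 : ℕ) : ℕ∞) := by exact_mod_cast h
      exact absurd h' not_top_lt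
    | coe n =>
      have h' : (n : ℕ∞) < ((d + 1 : ℕ) : ℕ∞) := by exact_mod_cast h
      have h'' : n < d + 1 := by exact_mod_cast h'
      exact_mod_cast Nat.lt_succ_iff.mp h''

/-- `n ≤ a < b` forces `n + 1 ≤ b` in `WithBot ℕ∞`, for a natural number `n`. [folklore] -/
private theorem WithBot.ENat.natCast_succ_le_of_le_of_lt {a b : WithBot ℕ∞} {n : ℕ} (h1 : (n : WithBot ℕ∞) ≤ a) (h2 : a < b) :
    ((n + 1 : ℕ) : WithBot ℕ∞) ≤ b := by
  induction b using WithBot.recBotCoe with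
  | bot => exact absurd (h1.trans_lt h2) (not_lt_bot)
  | coe b =>
    induction b using ENat.recTopCoe with
    | top => exact_mod_cast le_top
    | coe m =>
      induction a using WithBot.recBotCoe with
      | bot =>
        have : ((n : ℕ∞) : WithBot ℕ∞) ≤ ⊥ := by exact_mod_cast h1
        exact absurd this (by simp)
      | coe a =>
        induction a using ENat.recTopCoe with
        | top =>
          have : ((⊤ : ℕ∞) : WithBot ℕ∞) < ((m : ℕ∞) : WithBot ℕ∞) := by exact_mod_cast h2
          exact absurd (WithBot.coe_lt_coe.mp this) not_top_lt
        | coe a =>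
          have h1' : (n : ℕ∞) ≤ (a : ℕ∞) := by exact_mod_cast h1
          have h2' : (a : ℕ∞) < (m : ℕ∞) := by exact_mod_cast h2
          have h1'' : n ≤ a := by exact_mod_cast h1'
          have h2'' : a < m := by exact_mod_cast h2'
          have : n + 1 ≤ m := by omega
          exact_mod_cast this

/-! ## Closed points of a proper scheme over a local ring -/

variable {O : Type} [CommRing O] [IsLocalRing O] {C : Scheme.{0}} (r : C ⟶ Spec (.of O))

/-- **A closed point of a universally closed `O`-scheme (`O` local) lies over the closed point of `O`**: `r` is a closed map, so `{r y}` is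
closed, and every point of `Spec O` specialises to the closed point. [cite: GortzWedhorn2020, Remark 12.57] [folklore] -/
theorem apply_eq_closedPoint_of_isClosed_singleton [UniversallyClosed r] (y : C) (hy : IsClosed ({y} : Set C)) :
    r y = closedPoint O := by
  have himg : IsClosed ({r y} : Set (Spec (.of O))) := by
    have h := r.isClosedMap _ hy
    rwa [Set.image_singleton] at h
  have hmem : closedPoint O ∈ ({r y} : Set (Spec (.of O))) :=
    (IsLocalRing.specializes_closedPoint (r y)).mem_closed himg rfl
  exact (Set.mem_singleton_iff.mp hmem).symm

/-! ## Stalk dimensions on the generic fibre -/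

/-- **The generic fibre of a proper `O`-scheme has dimension one less.** Let `O` be a local ring and `r : C → Spec O` PROPER with `C`
locally Noetherian. If `dim 𝒪_{C,c} ≤ d + 1` at every CLOSED point `c` of `C`, then `dim 𝒪_{C,x} ≤ d` at every point `x` of `C` that
does not lie over the closed point of `O` — every point specialises to a closed point (`C` is quasi-compact), closed points lie over the
closed point, and the stalk dimension drops strictly along the proper specialization (Stacks 02IZ). At `d = 1`: the points of the generic
fibre of a proper `O`-scheme of dimension `2` have stalk dimension `≤ 1`. [cite: StacksProject, Tag 02IZ] [folklore] -/
theorem ringKrullDim_stalk_le_of_ne_closedPoint [IsLocallyNoetherian C] [IsProper r] {d : ℕ}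
    (hdim : ∀ c : C, IsClosed ({c} : Set C) → ringKrullDim (C.presheaf.stalk c) ≤ ((d + 1 : ℕ) : WithBot ℕ∞))
    (x : C) (hx : r x ≠ closedPoint O) :
    ringKrullDim (C.presheaf.stalk x) ≤ (d : WithBot ℕ∞) := by
  haveI : CompactSpace C := QuasiCompact.compactSpace_of_compactSpace r
  obtain ⟨c, hcx, hccl⟩ := (isClosed_closure (s := ({x} : Set C))).exists_closed_singleton ⟨x, subset_closure rfl⟩
  have h : x ⤳ c := specializes_iff_mem_closure.mpr hcx
  have hne : x ≠ c := by
    rintro rfl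
    exact hx (apply_eq_closedPoint_of_isClosed_singleton r x hccl)
  exact WithBot.ENat.le_natCast_of_lt_succ ((ringKrullDim_stalk_lt_of_specializes h hne).trans_le (hdim c hccl))

/-- **Points other than the generic point have positive stalk dimension.** On an irreducible locally Noetherian scheme `X`, for every point
`x` other than the generic point: `1 ≤ dim 𝒪_{X,x}` (the generic point is a proper generization of `x`, Stacks 02IZ).
[cite: StacksProject, Tag 02IZ] [folklore] -/
theorem one_le_ringKrullDim_stalk_of_ne_genericPoint {X : Scheme.{u}} [IsLocallyNoetherian X] [IrreducibleSpace X] (x : X)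
    (hx : x ≠ genericPoint X) : (1 : WithBot ℕ∞) ≤ ringKrullDim (X.presheaf.stalk x) := by
  have h := ringKrullDim_stalk_lt_of_specializes (genericPoint_specializes x) (Ne.symm hx)
  have h0 : (0 : WithBot ℕ∞) ≤ ringKrullDim (X.presheaf.stalk (genericPoint X)) := ringKrullDim_nonneg_of_nontrivial
  exact_mod_cast WithBot.ENat.natCast_succ_le_of_le_of_lt (n := 0) (by exact_mod_cast h0) h

/-! ## Finiteness of closed subsets of the generic fibre -/

/-- **Closed subsets of the generic fibre of positive-dimensional points are finite.** Let `O` be local, `r : C → Spec O` proper, `C`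
locally Noetherian, and assume `dim 𝒪_{C,x} ≤ 1` at every point of the generic-fibre locus `{x | r x ≠ 𝔪_O}` (hypothesis `h1`; e.g. from
`ringKrullDim_stalk_le_of_ne_closedPoint` at `d = 1`). Let `T` be a set of generic-fibre points which is CLOSED IN THE GENERIC-FIBRE LOCUS
(`hTcl`: a point of `closure T` off the closed point is in `T`) and consists of points of NON-ZERO stalk dimension (`hT0`: `T` misses the
generic points). Then `T` is finite: a generization `y ⤳ x` of `x ∈ T` inside `closure T` lies off the closed point (the closed point of
`Spec O` is closed), hence in `T`, hence has `0 < dim 𝒪_y ≤ 1`; were `y ≠ x` the dimension would drop below `dim 𝒪_x ≤ 1`, i.e. to `0` —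
so the points of `T` are maximal in `closure T`, and maximal points of a closed subset of a Noetherian sober space are finite.
[cite: StacksProject, Tag 0052] [folklore] -/
theorem Set.Finite.of_closed_in_genericFibre [IsLocallyNoetherian C] [IsProper r]
    (h1 : ∀ x : C, r x ≠ closedPoint O → ringKrullDim (C.presheaf.stalk x) ≤ (1 : WithBot ℕ∞))
    (T : Set C) (hT : ∀ x ∈ T, r x ≠ closedPoint O) (hTcl : ∀ x ∈ closure T, r x ≠ closedPoint O → x ∈ T)
    (hT0 : ∀ x ∈ T, ringKrullDim (C.presheaf.stalk x) ≠ 0) : T.Finite := by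
  haveI : CompactSpace C := QuasiCompact.compactSpace_of_compactSpace r
  haveI : IsNoetherian C := {}
  refine Set.Finite.of_forall_specializes_eq (isClosed_closure (s := T)) subset_closure fun x hx y hy hyx => ?_
  -- `y` lies off the closed point: `r y ⤳ r x` and the closed point only specialises to itself
  have hyK : r y ≠ closedPoint O := by
    intro hry
    have hsp : r y ⤳ r x := hyx.map r.continuous
    rw [hry] at hsp
    exact hT x hx (hsp.mem_closed (IsLocalRing.isClosed_singleton_closedPoint O) rfl)
  have hyT : y ∈ T := hTcl y hy hyK
  by_contra hne
  have hlt : ringKrullDim (C.presheaf.stalk y) < (1 : WithBot ℕ∞) :=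
    (ringKrullDim_stalk_lt_of_specializes hyx hne).trans_le (h1 x (hT x hx))
  have hle : ringKrullDim (C.presheaf.stalk y) ≤ ((0 : ℕ) : WithBot ℕ∞) :=
    WithBot.ENat.le_natCast_of_lt_succ (d := 0) (by exact_mod_cast hlt)
  have hge : (0 : WithBot ℕ∞) ≤ ringKrullDim (C.presheaf.stalk y) := ringKrullDim_nonneg_of_nontrivial
  exact hT0 y hyT (le_antisymm (by exact_mod_cast hle) hge)

/-- **Points of the generic fibre are incomparable** (away from the generic point). Let `O` be local and `r : C → Spec O` proper with
`C` irreducible, locally Noetherian and `dim 𝒪_{C,c} ≤ 2` at the closed points. If `x ⤳ x'` with `x'` NOT over the closed point of `O`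
and `x` not the generic point of `C`, then `x = x'` (else `dim 𝒪_{C,x'} > dim 𝒪_{C,x} ≥ 1`, contradicting `dim 𝒪_{C,x'} ≤ 1`).
[cite: StacksProject, Tag 02IZ] [folklore] -/
theorem specializes_eq_of_ne_closedPoint [IsLocallyNoetherian C] [IrreducibleSpace C] [IsProper r]
    (hdim : ∀ c : C, IsClosed ({c} : Set C) → ringKrullDim (C.presheaf.stalk c) ≤ ((2 : ℕ) : WithBot ℕ∞))
    {x x' : C} (hx' : r x' ≠ closedPoint O) (hgen : x ≠ genericPoint C) (h : x ⤳ x') : x = x' := by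
  by_contra hne
  have h1 : (1 : WithBot ℕ∞) ≤ ringKrullDim (C.presheaf.stalk x) := one_le_ringKrullDim_stalk_of_ne_genericPoint x hgen
  have h2 : ringKrullDim (C.presheaf.stalk x') ≤ ((1 : ℕ) : WithBot ℕ∞) :=
    ringKrullDim_stalk_le_of_ne_closedPoint r (d := 1) hdim x' hx'
  have h3 := ringKrullDim_stalk_lt_of_specializes h hne
  have h4 : (1 : WithBot ℕ∞) < ((1 : ℕ) : WithBot ℕ∞) := (h1.trans_lt h3).trans_le h2
  exact absurd h4 (by decide)

/-- **Fibres over the generic fibre are finite** (the form Mathlib's `locallyQuasiFinite_iff_finite_preimage_singleton` consumes). Let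
`O` be local and `r : C → Spec O` proper with `C` irreducible, locally Noetherian and `dim 𝒪_{C,c} ≤ 2` at the closed points; let
`φ : C → P` be ANY morphism and `y : P` a point all of whose `φ`-preimages lie off the closed point of `O` (e.g. `y` in the generic fibre of an
`O`-scheme `P`, `φ` over `Spec O`) and which is not the image of the generic point of `C`. Then `φ ⁻¹' {y}` is finite: inside the closed
`φ ⁻¹' (closure {y})` the fibre points are maximal (a generization `z ⤳ x` of a fibre point inside it maps to a generization of `y` lying in
`closure {y}`, i.e. to `y`; `z ≠ η_C`; then `specializes_eq_of_ne_closedPoint`). [cite: StacksProject, Tag 0052] [folklore] -/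
theorem Set.Finite.preimage_singleton_of_ne_closedPoint [IsLocallyNoetherian C] [IrreducibleSpace C] [IsProper r]
    (hdim : ∀ c : C, IsClosed ({c} : Set C) → ringKrullDim (C.presheaf.stalk c) ≤ ((2 : ℕ) : WithBot ℕ∞))
    {P : Scheme.{0}} (φ : C ⟶ P) (y : P) (hy : ∀ x : C, φ x = y → r x ≠ closedPoint O) (hgen : φ (genericPoint C) ≠ y) :
    (φ ⁻¹' {y} : Set C).Finite := by
  haveI : CompactSpace C := QuasiCompact.compactSpace_of_compactSpace r
  haveI : IsNoetherian C := {}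
  have hS : IsClosed (φ ⁻¹' closure ({y} : Set P)) := isClosed_closure.preimage φ.continuous
  refine Set.Finite.of_forall_specializes_eq hS (Set.preimage_mono subset_closure) fun x hx z hz hzx => ?_
  have hxy : φ x = y := hx
  have hzy : φ z = y := by
    have h1 : φ z ⤳ y := hxy ▸ hzx.map φ.continuous
    have h2 : y ⤳ φ z := specializes_iff_mem_closure.mpr hz
    exact (h1.antisymm h2).eq
  exact specializes_eq_of_ne_closedPoint r hdim (hy x hxy) (fun h => hgen (h ▸ hzy)) hzx

/-! ## Strict specialisations of a generic-fibre point of an `O`-surface are closed points -/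

/-- **On a scheme with stalks of dimension `≤ 2`, a strict specialisation of a point of stalk dimension `≥ 1` is a closed point.** If
`dim 𝒪_{C,z} ≤ 2` everywhere, `1 ≤ dim 𝒪_{C,x}`, and `x ⤳ x'` with `x ≠ x'`, then `{x'}` is closed: `dim 𝒪_{C,x'} ≥ 2` is maximal, so `x'`
has no strict specialisation. [cite: StacksProject, Tag 02IZ] [folklore] -/
theorem isClosed_singleton_of_specializes_of_ne [IsLocallyNoetherian C]
    (h2 : ∀ z : C, ringKrullDim (C.presheaf.stalk z) ≤ ((2 : ℕ) : WithBot ℕ∞))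
    {x x' : C} (hx1 : (1 : WithBot ℕ∞) ≤ ringKrullDim (C.presheaf.stalk x)) (h : x ⤳ x') (hne : x ≠ x') :
    IsClosed ({x'} : Set C) := by
  have hx'2 : ((2 : ℕ) : WithBot ℕ∞) ≤ ringKrullDim (C.presheaf.stalk x') :=
    WithBot.ENat.natCast_succ_le_of_le_of_lt (n := 1) (by exact_mod_cast hx1) (ringKrullDim_stalk_lt_of_specializes h hne)
  refine isClosed_of_closure_subset fun z hz => ?_
  have hxz : x' ⤳ z := specializes_iff_mem_closure.mpr hz
  by_contra hzne
  have hz3 : ((3 : ℕ) : WithBot ℕ∞) ≤ ringKrullDim (C.presheaf.stalk z) :=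
    WithBot.ENat.natCast_succ_le_of_le_of_lt (n := 2) hx'2 (ringKrullDim_stalk_lt_of_specializes hxz (Ne.symm hzne))
  have h := hz3.trans (h2 z)
  exact absurd h (by decide)

/-- **The closure of a generic-fibre point meets the closed fibre in finitely many (closed) points.** Let `O` be local, `r : C → Spec O`
proper, `C` locally Noetherian with `dim 𝒪_{C,z} ≤ 2` everywhere, and `x` a point OFF the closed point with `1 ≤ dim 𝒪_{C,x}`. Then every point
of `closure {x}` over the closed point is a closed point (`isClosed_singleton_of_specializes_of_ne`), and `closure {x} ∩ r ⁻¹' {𝔪_O}` is finite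
(a closed set of closed points in a Noetherian sober space). [cite: StacksProject, Tag 0052] [folklore] -/
theorem finite_closure_singleton_inter_closedFibre [IsLocallyNoetherian C] [IsProper r]
    (h2 : ∀ z : C, ringKrullDim (C.presheaf.stalk z) ≤ ((2 : ℕ) : WithBot ℕ∞))
    (x : C) (hx : r x ≠ closedPoint O) (hx1 : (1 : WithBot ℕ∞) ≤ ringKrullDim (C.presheaf.stalk x)) :
    (closure ({x} : Set C) ∩ r ⁻¹' {closedPoint O}).Finite ∧
      ∀ x' ∈ closure ({x} : Set C) ∩ r ⁻¹' {closedPoint O}, IsClosed ({x'} : Set C) := by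
  haveI : CompactSpace C := QuasiCompact.compactSpace_of_compactSpace r
  haveI : IsNoetherian C := {}
  have hcl : ∀ x' ∈ closure ({x} : Set C) ∩ r ⁻¹' {closedPoint O}, IsClosed ({x'} : Set C) := by
    rintro x' ⟨hx', hrx'⟩
    refine isClosed_singleton_of_specializes_of_ne h2 hx1 (specializes_iff_mem_closure.mpr hx') ?_
    rintro rfl
    exact hx hrx'
  refine ⟨?_, hcl⟩
  have hM : IsClosed (closure ({x} : Set C) ∩ r ⁻¹' {closedPoint O}) :=
    isClosed_closure.inter ((IsLocalRing.isClosed_singleton_closedPoint O).preimage r.continuous)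
  refine Set.Finite.of_forall_specializes_eq hM subset_rfl fun x' hx' y hy hyx' => ?_
  have hycl := hcl y hy
  have hmem : x' ∈ closure ({y} : Set C) := specializes_iff_mem_closure.mp hyx'
  rw [hycl.closure_eq] at hmem
  exact (Set.mem_singleton_iff.mp hmem).symm

end Literature.AlgebraicGeometry.Morphisms

end
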